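import Literature.NumberTheory.Automorphic.Liu2021.Thm418CyclotomicUnitsLocalNorms
import Literature.NumberTheory.Automorphic.Liu2021.LemD1AsPrintedIndexedNonVacuityRamifiedPlace
import Literature.NumberTheory.GelbartRogawski1991.CMSplittingCharLocalComponents
import Literature.NumberTheory.GaloisRepresentations.PadicAlgebraOfLocalField
import Literature.NumberTheory.QuadraticForms.HilbertSymbolNormCompat
import Literature.NumberTheory.QuadraticForms.PadicTwoHilbertSymbolCyclotomicCases
import Literature.NumberTheory.QuadraticForms.PadicSquareClasses
import Literature.NumberTheory.QuadraticForms.HilbertSymbolDyadicFive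
import Literature.NumberTheory.NumberFields.CompletionLocalDegree
import Mathlib.NumberTheory.Cyclotomic.CyclotomicCharacter
import Mathlib.RingTheory.RootsOfUnity.AlgebraicallyClosed
import HarnessLib

/-!
# [Liu2021, Thm 4.18 (3), proof l. 2279–2289] — the number-theoretic core (NT) at the DYADIC places,
# modulo the projection formula of local class field theory at `2`

Topic `NumberTheory/Automorphic/Liu2021`; namespace `Literature.NumberTheory.Automorphic.Liu2021`.  THEOREMS only (no
definition, no named fact of its own, no `sorry`); every statement that uses local class field theory at `2` carries the
hypothesis `(hNC : QuadraticForms.HilbertSymbolNormCompatAtTwo)` — the tree's NAMED FACT «`(a, b)_K = (a, N_{K/ℚ₂} b)_{ℚ₂}`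
for `a ∈ ℚ₂ˣ`, `K/ℚ₂` finite» ([NeukirchANT1999] IV (6.4) with V (3.1)–(3.2); `QuadraticForms/HilbertSymbolNormCompat`).
Companion of `Thm418CyclotomicUnitsLocalNorms` / `Thm418CyclotomicUnitIsLocalNormOdd` (the places not above `2`, no fact).
Cell `hodgecm-mathlib` (D-0151), row III-11c `CyclotomicUnitIsLocalNormDyadic` (A-p19's `A3Liu418EpsRigidFaceTypes`).
HC_CM is proved only modulo the 7 printed citations until rung 0 closes.

THE PRINT ([Liu2021] l. 2279–2289, `p = 2`): «`M_{E/F}` is `ℚ(√−1)`, `ℚ(√2)` or `ℚ(√−2)` … contained in `M_μ`».  UNIFORM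
FORMULATION (no Eisenstein polynomials, no [BH06]; it also covers the case `f(F_𝔭/ℚ₂)` even where the printed sentence
l. 2283 is inaccurate — lit1's remark recorded in `Thm418EpsRigidUnderGaloisTwist`): for `σ ∈ Aut(ℂ/M_μ)` let
`u = χ_{cyc,2}(σ) ∈ ℤ₂ˣ`, `m ≡ u (mod 8)`, and `θ = cmQuadraticGenerator L`, `𝔭 ∣ 2` a place of `L⁺` with `θ ∉ (L⁺_𝔭)²`
(non-split), `N = N_{L⁺_𝔭/ℚ₂} θ = 2^α w · c²` (`w ∈ ℤ₂ˣ`, `α ∈ {0,1}`).  By the projection formula and Serre's explicit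
`2`-adic symbol ([Serre1973] III §1.2 Thm. 1, tree `hilbertSymbol_padic_two_pow_mul_unit`):
`(u, θ)_𝔭 = (u, N)_{ℚ₂} = (−1)^{ε(m)ε(w)} χ₈(m)^α`, `ε𝔭 := (−1, θ)_𝔭 = (−1)^{ε(w)}`, `(5, θ)_𝔭 = (−1)^α`; on the `𝔭`-adic
side `(5, θ)_𝔭 = (θ, 1 + 4·1)_𝔭 = (−1)^{ord_𝔭 θ · [f odd]}` (O'Meara 63:16, tree `HilbertSymbolUnramified`; `5 ∈ (L⁺_𝔭)²` iff
`x² + x + 1` has a root in `𝔽_{2^f}` iff `f` even), so `α ≡ f · ord_𝔭 θ =: B (mod 2)`; and the cell's step L3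
(`Thm418MuFieldContainsNormField`, at the place `w ∣ 𝔭`, `e(w|𝔭) f(w|𝔭) = 2`) gives `√c₀ ∈ M_μ`, `c₀ = ε𝔭 · 2^B`, whence by
step L2 (`Thm418CyclotomicSquareRoots`): `ε𝔭 = −1 ⇒ m ≡ 1 (4)` if `B` even, `m ∈ {1, 3} (8)` if `B` odd; `ε𝔭 = 1, B` odd
`⇒ m ≡ ±1 (8)`.  In each case `(−1)^{ε(m)ε(w)} χ₈(m)^α = 1`, i.e. `(u, θ)_𝔭 = 1`: `u` is a norm from `L_w`.

WHAT IS PROVED (`L` CM, `L⁺` its maximal real subfield, `θ = cmQuadraticGenerator L`).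
* §1 `ℚ₂`-side corollaries of Serre's formula (tree `hilbertSymbol_padic_two_unit_pow_mul_unit`, B-p21):
  `hilbertSymbol_padic_neg_one_two_pow_mul_unit` (`(−1, 2^α w)_2 = epsSign (−1) m'`),
  `hilbertSymbol_padic_five_two_pow_mul_unit` (`(5, 2^α w)_2 = (−1)^α`).
* §2 (the `𝔭`-adic side `(t, 5)_v = −1 ↔ f, ord_v t odd` is `QuadraticForms/HilbertSymbolDyadicFive`).
* §3 `exists_mem_fieldOfValues_sq_eq_hilbertSymbol_neg_one_mul_zpow` — step L3 at a NON-SPLIT place `𝔭 ∣ p` of `L⁺`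
  (`N 𝔭 = p^f`, any `p`): `∃ z ∈ M_μ, z² = (−1, θ)_𝔭 · p^{−f · log v_𝔭 θ}`.
* §4 **`hilbertSymbol_cyclotomicCharacter_cmQuadraticGenerator_eq_one_of_normCompatAtTwo`** — (NT) at `𝔭 ∣ 2` modulo the
  named fact: `(χ_{cyc,2}(σ), θ)_𝔭 = 1` for `σ ∈ Aut(ℂ/M_μ)`, `μ = ψ` conjugate symplectic.
The road-currency adapter (`κ` with `σ ∘ ψ_𝔭 = ψ_𝔭(κ ·)` is a norm from `E_𝔭`) and the Summits closer
`CyclotomicUnitIsLocalNormDyadic` (modulo the fact) are separate files.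

## References
* [Liu2021] Y. Liu, *Fourier–Jacobi cycles and arithmetic relative trace formula*, Camb. J. Math. 9 (2021), proof of
  Thm. 4.18 (3), TeX l. 2279–2289.
* [Serre1973] J.-P. Serre, *A Course in Arithmetic* (1973), Ch. II §3.3, Ch. III §1.2 Thm. 1.
* [NeukirchANT1999] J. Neukirch, *Algebraic Number Theory* (1999), IV (6.4), V (3.1)–(3.2).
* [Omeara1963] O. T. O'Meara, *Introduction to Quadratic Forms* (1963), §63A, §63C Example 63:16.
-/

set_option autoImplicit false

noncomputable section

open scoped NumberField Valued
open NumberField IsDedekindDomain IsDedekindDomain.HeightOneSpectrum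

namespace Literature.NumberTheory.Automorphic.Liu2021

open Literature.NumberTheory.QuadraticForms Literature.NumberTheory.GaloisRepresentations
open Literature.NumberTheory.Automorphic Literature.NumberTheory.NumberFields

/-! ## §1 `2`-adic bookkeeping: square classes of `ℚ₂ˣ` and Serre's symbol against `u`, `−1`, `5` -/

/-- A `2`-adic unit given by an odd integer `m'`: `‖m'‖ = 1`. [folklore] -/
private theorem Padic.norm_intCast_eq_one_of_odd {m' : ℤ} (hm' : ¬ (2 : ℤ) ∣ m') : ‖((m' : ℤ) : ℚ_[2])‖ = 1 := by
  refine le_antisymm (Padic.norm_int_le_one m') ?_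
  by_contra hlt
  rw [not_le, Padic.norm_intCast_lt_one_iff] at hlt
  exact hm' (by exact_mod_cast hlt)

/-- The residue mod `8` of the `2`-adic unit given by an odd integer `m'` is `m'`. [folklore] -/
private theorem PadicInt.toZModPow_mkUnits_intCast {m' : ℤ} (h : ‖((m' : ℤ) : ℚ_[2])‖ = 1) :
    PadicInt.toZModPow 3 ((PadicInt.mkUnits h : ℤ_[2]ˣ) : ℤ_[2]) = ((m' : ℤ) : ZMod (2 ^ 3)) := by
  have hZ : ((PadicInt.mkUnits h : ℤ_[2]ˣ) : ℤ_[2]) = ((m' : ℤ) : ℤ_[2]) := by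
    apply Subtype.ext
    change ((m' : ℤ) : ℚ_[2]) = (((m' : ℤ) : ℤ_[2]) : ℚ_[2])
    rw [PadicInt.coe_intCast]
  rw [hZ, map_intCast]

/-- `(−1, 2^α w)_2 = epsSign (−1) m'` (`χ₈(−1) = 1`). [cite: Serre1973, Ch. III §1.2 Thm 1] -/
theorem hilbertSymbol_padic_neg_one_two_pow_mul_unit (w : ℤ_[2]ˣ) {m' : ℤ}
    (hm' : PadicInt.toZModPow 3 (w : ℤ_[2]) = (m' : ZMod (2 ^ 3))) (α : ℕ) :
    hilbertSymbol ℚ_[2] (-1) ((2 : ℚ_[2]) ^ α * ((w : ℤ_[2]) : ℚ_[2])) = epsSign (-1) m' := by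
  have h1 : PadicInt.toZModPow 3 ((-1 : ℤ_[2]ˣ) : ℤ_[2]) = ((-1 : ℤ) : ZMod (2 ^ 3)) := by simp
  have h := hilbertSymbol_padic_two_unit_pow_mul_unit (-1) w h1 hm' α
  have hχ : ZMod.χ₈ ((-1 : ℤ) : ZMod 8) = 1 := by decide
  rw [Units.val_neg, Units.val_one, PadicInt.coe_neg, PadicInt.coe_one, hχ, one_pow, mul_one] at h
  exact h

/-- `(5, 2^α w)_2 = (−1)^α` (`ε(5)` even, `χ₈(5) = −1`). [cite: Serre1973, Ch. III §1.2 Thm 1] -/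
theorem hilbertSymbol_padic_five_two_pow_mul_unit (w : ℤ_[2]ˣ) {m' : ℤ}
    (hm' : PadicInt.toZModPow 3 (w : ℤ_[2]) = (m' : ZMod (2 ^ 3))) (α : ℕ) :
    hilbertSymbol ℚ_[2] (5 : ℚ_[2]) ((2 : ℚ_[2]) ^ α * ((w : ℤ_[2]) : ℚ_[2])) = (-1) ^ α := by
  -- `5` as a `2`-adic unit
  have h5 : ‖((5 : ℤ) : ℚ_[2])‖ = 1 := Padic.norm_intCast_eq_one_of_odd (by decide)
  have h := hilbertSymbol_padic_two_unit_pow_mul_unit (PadicInt.mkUnits h5) w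
    (PadicInt.toZModPow_mkUnits_intCast h5) hm' α
  have hv : (((PadicInt.mkUnits h5 : ℤ_[2]ˣ) : ℤ_[2]) : ℚ_[2]) = 5 := by
    change ((5 : ℤ) : ℚ_[2]) = 5
    norm_num
  rw [hv] at h
  rw [h]
  have hε : epsSign 5 m' = 1 := by
    unfold epsSign
    rw [if_neg]
    intro hc
    exact absurd hc.1 (by decide)
  have hχ : ZMod.χ₈ ((5 : ℤ) : ZMod 8) = -1 := by decide
  rw [hε, hχ, one_mul]

/-! ## §2 The residue degree of a dyadic place -/

section Local

variable {K : Type} [Field K] [NumberField K] (v : HeightOneSpectrum (𝓞 K))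

/-- The residue degree of a dyadic place: `N 𝔭_v = 2^f`. [folklore] -/
private theorem exists_absNorm_eq_two_pow (h2 : (2 : 𝓞 K) ∈ v.asIdeal) :
    ∃ f : ℕ, Ideal.absNorm v.asIdeal = 2 ^ f := by
  letI := Ideal.Quotient.field v.asIdeal
  letI : Fintype (𝓞 K ⧸ v.asIdeal) := Fintype.ofFinite _
  haveI : CharP (𝓞 K ⧸ v.asIdeal) 2 := by
    refine (CharP.charP_iff_prime_eq_zero Nat.prime_two).mpr ?_
    rw [← map_natCast (Ideal.Quotient.mk v.asIdeal), Ideal.Quotient.eq_zero_iff_mem]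
    exact_mod_cast h2
  obtain ⟨n, -, hn⟩ := FiniteField.card (𝓞 K ⧸ v.asIdeal) 2
  refine ⟨n, ?_⟩
  rw [Ideal.absNorm_apply, Submodule.cardQuot_apply, Nat.card_eq_fintype_card]
  exact hn

end Local

/-! ## §3 Step L3 at a non-split place: `√(ε𝔭 · p^{−f ord_𝔭 θ}) ∈ M_μ` -/

section CM

variable {L : Type} [Field L] [NumberField L] [IsCMField L]

local notation3 "L⁺" => maximalRealSubfield L

open IdeleClassGroup GelbartRogawski1991.UnitaryDualPair in
/-- **L3 at a non-split place `𝔭` of `L⁺` above `p`, `N 𝔭 = p^f`**: if `θ = cmQuadraticGenerator L` is not a square in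
`L⁺_𝔭` then there is `z ∈ M_μ = fieldOfValues L ψ` with `z² = (−1, θ)_𝔭 · p^{−f · ord data}` — precisely
`z² = ε_{L/L⁺}(⟨−1⟩_𝔭) · p^{−f ℓ}`, `ℓ = log v_𝔭(θ)`: the cell's step L3 (`Thm418MuFieldContainsNormField`, `√c ∈ M_μ`,
`c = ψ[⟨−1⟩_w] (N w)^{−n}`, `‖√θ‖_w = (N w)^n`) at the place `w ∣ 𝔭` (`c • w = w` since `𝔭` is not split), with
`e(w|𝔭) f(w|𝔭) = 2` (`LemD1IndexedNonVacuityRamifiedPlace`): `(N w)^n = p^{f f(w|𝔭) n}` and `2n = e(w|𝔭) ℓ`, so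
`f(w|𝔭) n = ℓ` in both cases; and `ψ[⟨−1⟩_w] = ε_{L/L⁺}(⟨−1⟩_𝔭) = (−1, θ)_𝔭` (`quadraticHeckeChar_localUnits`).
[cite: Liu2021, proof of Thm. 4.18 (3), l. 2262–2270 and l. 2279–2289] -/
theorem exists_mem_fieldOfValues_sq_eq_hilbertSymbol_neg_one_mul_zpow
    {ψ : IdeleClassGroup L →ₜ* Circle} (hψ : IsConjugateSymplectic L ψ)
    (𝔭 : HeightOneSpectrum (𝓞 L⁺)) {p : ℕ} [Fact p.Prime] {f : ℕ} (hf : Ideal.absNorm 𝔭.asIdeal = p ^ f)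
    (hns : ¬ IsSquare (algebraMap (L⁺) (𝔭.adicCompletion L⁺) ((cmQuadraticGenerator L : 𝓞 L⁺) : L⁺))) :
    ∃ z ∈ fieldOfValues L ψ, z ^ 2 =
      (hilbertSymbol (𝔭.adicCompletion L⁺) (-1)
          (algebraMap (L⁺) (𝔭.adicCompletion L⁺) ((cmQuadraticGenerator L : 𝓞 L⁺) : L⁺)) : ℂ) *
        (p : ℂ) ^ (-((f : ℤ) *
          WithZero.log (Valued.v (algebraMap (L⁺) (𝔭.adicCompletion L⁺) ((cmQuadraticGenerator L : 𝓞 L⁺) : L⁺))))) := by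
  classical
  have hpr : p.Prime := Fact.out
  set θ : 𝓞 L⁺ := cmQuadraticGenerator L with hθdef
  have hθns : ¬ IsSquare ((θ : 𝓞 L⁺) : L⁺) := not_isSquare_cmQuadraticGenerator L
  have hθ0 : (θ : 𝓞 L⁺) ≠ 0 := fun h0 ↦ hθns (by rw [h0]; exact ⟨0, by simp⟩)
  have hθF0 : ((θ : 𝓞 L⁺) : L⁺) ≠ 0 := RingOfIntegers.coe_ne_zero_iff.mpr hθ0
  obtain ⟨α, hα0, hαc, hαsq⟩ := cmQuadraticGenerator_spec L
  set d : (L⁺)ˣ := Units.mk0 ((θ : 𝓞 L⁺) : L⁺) hθF0 with hddef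
  set k₀ : Lˣ := Units.mk0 α hα0 with hk₀def
  have hd : algebraMap (L⁺) L (d : L⁺) = (k₀ : L) ^ 2 := by
    rw [hddef, hk₀def, Units.val_mk0, Units.val_mk0, ← hαsq]
  -- a place `w` of `L` above `𝔭`, fixed by `c` (non-split)
  obtain ⟨⟨w, hw𝔭⟩⟩ := UnitaryGroup.PlacesOver.nonempty (F := L⁺) L 𝔭
  haveI hlies : w.asIdeal.LiesOver 𝔭.asIdeal := ⟨congrArg HeightOneSpectrum.asIdeal hw𝔭.symm⟩
  have hw : IsCMField.complexConj L • w = w := by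
    by_contra hne
    exact hns (LocalSplitting.isSquare_cmQuadraticGenerator_of_smul_ne L 𝔭 ⟨w, hw𝔭⟩ hne)
  -- `e(w|𝔭) f(w|𝔭) = 2`
  have hdich := LemD1IndexedNonVacuityRamifiedPlace.ramificationIdx_inertiaDeg_dichotomy_of_smul_eq L 𝔭
    (IsCMField.complexConj L) (IsCMField.complexConj_ne_one L) ⟨w, hw𝔭⟩ hw
  dsimp only at hdich
  have he' : (w.under (𝓞 L⁺)).asIdeal.ramificationIdx' w.asIdeal = w.asIdeal.ramificationIdx (𝓞 L⁺) := by
    rw [hw𝔭]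
    exact Ideal.ramificationIdx'_eq_ramificationIdx 𝔭.asIdeal w.asIdeal 𝔭.ne_bot
  -- `N w = p^{f f(w|𝔭)}`
  have hNw : Ideal.absNorm w.asIdeal = p ^ (f * w.asIdeal.inertiaDeg (𝓞 L⁺)) := by
    rw [Ideal.absNorm_eq_pow_inertiaDeg'_of_liesOver w.asIdeal 𝔭.asIdeal 𝔭.isPrime 𝔭.ne_bot,
      Ideal.inertiaDeg'_eq_inertiaDeg 𝔭.asIdeal w.asIdeal, hf, ← pow_mul]
  -- `ℓ = log v_𝔭 θ`, `n = log v_w √θ`, `2 n = e ℓ`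
  set ℓ : ℤ := WithZero.log ((w.under (𝓞 L⁺)).valuation (L⁺) (d : L⁺)) with hℓdef
  have hℓ : WithZero.log (Valued.v (algebraMap (L⁺) (𝔭.adicCompletion L⁺) ((θ : 𝓞 L⁺) : L⁺))) = ℓ := by
    rw [hℓdef, hw𝔭, hddef, Units.val_mk0, ← valuedAdicCompletion_eq_valuation']
    rfl
  set n : ℤ := WithZero.log (w.valuation L (k₀ : L)) with hndef
  have h2n : 2 * n = ((w.under (𝓞 L⁺)).asIdeal.ramificationIdx' w.asIdeal : ℤ) * ℓ :=
    Arthur2013.Leaves.TECR.TorusDict.two_mul_log_valuation_eq (F₀ := L⁺) (K := L) hd w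
  have hvα : Valued.v (α : w.adicCompletion L) =
      ((Multiplicative.ofAdd n : Multiplicative ℤ) : WithZero (Multiplicative ℤ)) := by
    have hne : w.valuation L (k₀ : L) ≠ 0 :=
      (Valuation.ne_zero_iff _).mpr (by rw [hk₀def, Units.val_mk0]; exact hα0)
    rw [valuedAdicCompletion_eq_valuation', show (α : L) = (k₀ : L) from by rw [hk₀def, Units.val_mk0],
      ← WithZero.exp_log hne]
    rfl
  have hnorm : ‖(α : w.adicCompletion L)‖ = ((Ideal.absNorm w.asIdeal : ℕ) : ℝ) ^ n :=
    Ultrametric.AdicCompletion.norm_eq_absNorm_zpow L w n hvα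
  -- L3
  obtain ⟨z, hzM, hz⟩ := exists_mem_fieldOfValues_sq_eq_of_isConjugateSymplectic hψ hw hαc hα0 hnorm
  -- the sign `ψ[⟨−1⟩_w] = ε_{L/L⁺}(⟨−1⟩_𝔭) = (−1, θ)_𝔭`
  have hsign : (ψ ((localUnits w (-1) : ideleGroup L) : IdeleClassGroup L) : ℂ) =
      (hilbertSymbol (𝔭.adicCompletion L⁺) (-1) (algebraMap (L⁺) (𝔭.adicCompletion L⁺) ((θ : 𝓞 L⁺) : L⁺)) : ℂ) := by
    rw [hψ.coe_apply_mk_localUnits_neg_one hw, quadraticHeckeCharCM_def, hw𝔭,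
      quadraticHeckeChar_localUnits (not_isSquare_cmQuadraticGenerator L) 𝔭 (-1), Units.val_neg, Units.val_one]
  -- the exponent: `f f(w|𝔭) n = f ℓ` in both cases `(e, f(w|𝔭)) = (1, 2), (2, 1)`
  have hexp : ((f * w.asIdeal.inertiaDeg (𝓞 L⁺) : ℕ) : ℤ) * n = (f : ℤ) * ℓ := by
    rw [he'] at h2n
    rcases hdich with ⟨he1, hf2⟩ | ⟨he2, hf1⟩
    · rw [hf2]
      rw [he1] at h2n
      push_cast at h2n ⊢
      rw [show ℓ = 2 * n by linarith]
      ring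
    · rw [hf1]
      rw [he2] at h2n
      push_cast at h2n ⊢
      rw [show ℓ = n by linarith]
      ring
  refine ⟨z, hzM, ?_⟩
  rw [hz, hsign, hNw, Nat.cast_pow, ← zpow_natCast (p : ℂ) (f * _), ← zpow_mul, mul_neg, hexp, hℓ]

/-! ## §4 (NT) at the dyadic places, modulo the projection formula -/

open IdeleClassGroup in
/-- **[Liu2021, Thm. 4.18 (3), (NT) at `𝔭 ∣ 2`] modulo the LOCAL projection formula at `𝔭`: `(χ_{cyc,2}(σ), θ)_𝔭 = 1`** —
the same statement as `hilbertSymbol_cyclotomicCharacter_cmQuadraticGenerator_eq_one_of_normCompatAtTwo` below, with the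
named fact `HilbertSymbolNormCompatAtTwo` weakened to its single instance actually used: the projection formula
`(a, b)_𝔭 = (a, N_{L⁺_𝔭/ℚ₂} b)_{ℚ₂}` (`a ∈ ℚ₂ˣ`, `b ∈ L⁺_𝔭ˣ`) for THIS completion with its canonical `ℚ₂`-structure — the
shape in which the cell discharges it for completions of number fields (Hilbert reciprocity + approximation, A-p13's
«III-11c global road», `hilbertSymbol_normCompat_adicCompletion_two`).
[cite: Liu2021, proof of Thm. 4.18 (3), l. 2279–2289] [cite: Serre1973, Ch. III §1.2 Thm 1] -/
theorem hilbertSymbol_cyclotomicCharacter_cmQuadraticGenerator_eq_one_of_localNormCompat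
    {ψ : IdeleClassGroup L →ₜ* Circle} (hψ : IsConjugateSymplectic L ψ)
    (σ : ℂ ≃+* ℂ) (hσ : ∀ z ∈ fieldOfValues L ψ, σ z = z)
    (𝔭 : HeightOneSpectrum (𝓞 L⁺)) (h2 : ((2 : ℕ) : 𝓞 L⁺) ∈ 𝔭.asIdeal)
    (hP : letI := LocalField.adicCompletionPadicAlgebra 𝔭 2 h2
      ∀ (a : ℚ_[2]) (b : 𝔭.adicCompletion L⁺), a ≠ 0 → b ≠ 0 →
        hilbertSymbol (𝔭.adicCompletion L⁺) (algebraMap ℚ_[2] (𝔭.adicCompletion L⁺) a) b =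
          hilbertSymbol ℚ_[2] a (Algebra.norm ℚ_[2] b)) :
    letI := LocalField.adicCompletionPadicAlgebra 𝔭 2 h2
    hilbertSymbol (𝔭.adicCompletion L⁺)
        (algebraMap ℚ_[2] (𝔭.adicCompletion L⁺) (((cyclotomicCharacter ℂ 2 σ : ℤ_[2]ˣ) : ℤ_[2]) : ℚ_[2]))
        (algebraMap (L⁺) (𝔭.adicCompletion L⁺) ((cmQuadraticGenerator L : 𝓞 L⁺) : L⁺)) = 1 := by
  classical
  letI := LocalField.adicCompletionPadicAlgebra 𝔭 2 h2
  haveI : CharZero (𝔭.adicCompletion L⁺) := charZero_of_injective_algebraMap (algebraMap (L⁺) _).injective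
  have h2' : (2 : 𝓞 L⁺) ∈ 𝔭.asIdeal := by exact_mod_cast h2
  -- `L⁺_𝔭 / ℚ₂` is finite
  haveI : FiniteDimensional ℚ_[2] (𝔭.adicCompletion L⁺) := by
    haveI := 𝔭.isPrime
    refine Module.finite_of_finrank_pos ?_
    rw [finrank_adicCompletionPadicAlgebra_eq 2 𝔭 h2]
    exact Nat.mul_pos (Ideal.ramificationIdx_pos _ _) (Ideal.inertiaDeg_pos _ _)
  set θK : 𝔭.adicCompletion L⁺ :=
    algebraMap (L⁺) (𝔭.adicCompletion L⁺) ((cmQuadraticGenerator L : 𝓞 L⁺) : L⁺) with hθKdef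
  have hθF0 : ((cmQuadraticGenerator L : 𝓞 L⁺) : L⁺) ≠ 0 := by
    exact_mod_cast RingOfIntegers.ne_zero_of_not_isSquare (L⁺) (not_isSquare_cmQuadraticGenerator L)
  have hθK0 : θK ≠ 0 := (map_ne_zero _).mpr hθF0
  set u : ℤ_[2]ˣ := cyclotomicCharacter ℂ 2 σ with hudef
  have hu0 : ((u : ℤ_[2]) : ℚ_[2]) ≠ 0 := PadicInt.coe_ne_zero.mpr (Units.ne_zero u)
  by_cases hsq : IsSquare θK
  · -- split: `θ ∈ (L⁺_𝔭)²`
    rw [hilbertSymbol_comm, hilbertSymbol_eq_one_of_isSquare hsq hθK0]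
  -- `u mod 8 = χ̄_8(σ)`
  have h8 : Nat.card (rootsOfUnity 8 ℂ) = 8 := HasEnoughRootsOfUnity.natCard_rootsOfUnity ℂ 8
  set u8 : (ZMod 8)ˣ := modularCyclotomicCharacter ℂ h8 σ with hu8def
  have hm : PadicInt.toZModPow 3 (u : ℤ_[2]) = ((((u8 : ZMod 8).val : ℕ) : ℤ) : ZMod (2 ^ 3)) := by
    rw [Int.cast_natCast]
    have h := cyclotomicCharacter.toZModPow 2 (n := 3) (L := ℂ) σ
    exact h.trans (ZMod.natCast_zmod_val _).symm
  have hmodd : Odd (((u8 : ZMod 8).val : ℕ) : ℤ) := by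
    have hcop : Nat.Coprime (u8 : ZMod 8).val 8 := ZMod.val_coe_unit_coprime u8
    have h2dvd : ¬ 2 ∣ (u8 : ZMod 8).val := fun h ↦ by
      have h' := Nat.dvd_gcd h (show 2 ∣ 8 by norm_num)
      rw [hcop] at h'
      omega
    exact_mod_cast Nat.odd_iff.mpr (by omega)
  -- `N_{L⁺_𝔭/ℚ₂} θ = 2^α m' c²`, `m'` an odd integer, `w = m'` the unit part
  have hN0 : Algebra.norm ℚ_[2] θK ≠ 0 := Algebra.norm_ne_zero_iff.mpr hθK0
  obtain ⟨α, m', c, -, hm'odd, hc0, hN⟩ := padic_exists_eq_pow_mul_int_mul_sq (p := 2) (Algebra.norm ℚ_[2] θK) hN0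
  have hm'1 : ‖((m' : ℤ) : ℚ_[2])‖ = 1 := Padic.norm_intCast_eq_one_of_odd (by exact_mod_cast hm'odd)
  set w : ℤ_[2]ˣ := PadicInt.mkUnits hm'1 with hwdef
  have hm' : PadicInt.toZModPow 3 (w : ℤ_[2]) = ((m' : ℤ) : ZMod (2 ^ 3)) := PadicInt.toZModPow_mkUnits_intCast hm'1
  have hwv : ((w : ℤ_[2]) : ℚ_[2]) = ((m' : ℤ) : ℚ_[2]) := rfl
  replace hN : Algebra.norm ℚ_[2] θK = (2 : ℚ_[2]) ^ α * ((w : ℤ_[2]) : ℚ_[2]) * c ^ 2 := by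
    rw [hN, hwv]
    push_cast
    ring
  -- the projection formula against `a ∈ ℚ₂ˣ`
  have hPw : ∀ a : ℚ_[2], a ≠ 0 → hilbertSymbol (𝔭.adicCompletion L⁺) (algebraMap ℚ_[2] _ a) θK =
      hilbertSymbol ℚ_[2] a ((2 : ℚ_[2]) ^ α * ((w : ℤ_[2]) : ℚ_[2])) := by
    intro a ha
    rw [hP a θK ha hθK0, hN, hilbertSymbol_mul_sq_right _ _ hc0]
  -- `ε𝔭 = (−1, θ)_𝔭 = epsSign (−1) m'`
  have hPneg : epsSign (-1) m' = hilbertSymbol (𝔭.adicCompletion L⁺) (-1) θK := by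
    have h := hPw (-1) (by norm_num)
    rw [map_neg, map_one, hilbertSymbol_padic_neg_one_two_pow_mul_unit w hm' α] at h
    exact h.symm
  -- `(5, θ)_𝔭 = (−1)^α`
  have hP5 : hilbertSymbol (𝔭.adicCompletion L⁺) 5 θK = (-1) ^ α := by
    have h := hPw 5 (by norm_num)
    rw [map_ofNat, hilbertSymbol_padic_five_two_pow_mul_unit w hm' α] at h
    exact h
  -- the `𝔭`-adic side: `(θ, 5)_𝔭 = −1 ↔ f, ord_𝔭 θ odd`
  obtain ⟨f, hf⟩ := exists_absNorm_eq_two_pow 𝔭 h2'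
  set ℓ : ℤ := WithZero.log (Valued.v θK) with hℓdef
  have h5 : (-1 : ℤ) ^ α = -1 ↔ Odd ((f : ℤ) * ℓ) := by
    have h := hilbertSymbol_five_eq_neg_one_iff 𝔭 h2' hf hθK0
    rw [hilbertSymbol_comm, hP5] at h
    rw [h, Int.odd_mul, Int.odd_coe_nat]
  -- L3: `z ∈ M_μ`, `z² = ε𝔭 2^{−f ℓ}`; rescale to `s² = ε𝔭 2^{r₀}`, `r₀ ∈ {0, 1}`
  haveI : Fact (Nat.Prime 2) := ⟨Nat.prime_two⟩
  obtain ⟨z, hzM, hz⟩ :=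
    exists_mem_fieldOfValues_sq_eq_hilbertSymbol_neg_one_mul_zpow (p := 2) hψ 𝔭 hf hsq
  have h20 : (2 : ℂ) ≠ 0 := two_ne_zero
  have h2M : (2 : ℂ) ∈ fieldOfValues L ψ := by exact_mod_cast natCast_mem (fieldOfValues L ψ) 2
  have key : ∀ (k : ℤ) (r₀ : ℕ), -((f : ℤ) * ℓ) = 2 * k + r₀ →
      ∃ s ∈ fieldOfValues L ψ, σ s = s ∧
        s ^ 2 = (hilbertSymbol (𝔭.adicCompletion L⁺) (-1) θK : ℂ) * 2 ^ r₀ := by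
    intro k r₀ hk
    refine ⟨z * (2 : ℂ) ^ (-k), mul_mem hzM (zpow_mem h2M (-k)), hσ _ (mul_mem hzM (zpow_mem h2M (-k))), ?_⟩
    rw [mul_pow, hz, ← zpow_natCast ((2 : ℂ) ^ (-k)) 2, ← zpow_mul, mul_assoc, Nat.cast_ofNat, ← zpow_add₀ h20, hk,
      ← zpow_natCast (2 : ℂ) r₀]
    congr 2
    push_cast
    ring
  -- `ε𝔭 = ±1` read on `m' (mod 4)`
  have hε_of_χ₄ : ∀ {t : ℤ}, ZMod.χ₄ (m' : ZMod 4) = t →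
      hilbertSymbol (𝔭.adicCompletion L⁺) (-1) θK = if t = -1 then -1 else 1 := by
    rintro t rfl
    rw [← hPneg, epsSign_neg_one_left]
  -- conclude by B-p21's reading of Liu's three cases on the `ℚ₂` side
  rw [hPw _ hu0]
  refine hilbertSymbol_padic_two_unit_pow_mul_unit_eq_one_of_cases u w hm hm' α ?_ ?_ ?_
  · -- `α` odd, `m' ≡ 1 (4)`: `ε𝔭 = 1`, `B` odd, `s² = 2`, so `χ₈(χ̄₈ σ) = 1`
    intro hα hχ
    have hε := hε_of_χ₄ hχ
    rw [if_neg (by decide)] at hε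
    obtain ⟨k, hk⟩ := h5.mp hα.neg_one_pow
    obtain ⟨s, -, hσs, hs⟩ := key (-k - 1) 1 (by rw [hk]; ring)
    rw [hε, pow_one, Int.cast_one, one_mul] at hs
    have h := (apply_eq_self_iff_of_sq_eq_two σ h8 hs).mp hσs
    rwa [Int.cast_natCast, ZMod.natCast_zmod_val]
  · -- `α` even, `m' ≡ 3 (4)`: `ε𝔭 = −1`, `B` even, `s² = −1`, so `χ̄₈(σ) ≡ 1 (mod 4)`
    intro hα hχ
    have hε := hε_of_χ₄ hχ
    rw [if_pos rfl] at hε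
    have hB : Even ((f : ℤ) * ℓ) := by
      rw [← Int.not_odd_iff_even, ← h5, hα.neg_one_pow]
      norm_num
    obtain ⟨k, hk⟩ := hB
    obtain ⟨s, -, hσs, hs⟩ := key (-k) 0 (by rw [hk]; ring)
    rw [hε, pow_zero, mul_one, Int.cast_neg, Int.cast_one] at hs
    have hs4 : s ^ 4 = 1 := by
      rw [show (4 : ℕ) = 2 * 2 by norm_num, pow_mul, hs]
      norm_num
    have hs8 : s ^ 8 = 1 := by
      rw [show (8 : ℕ) = 4 * 2 by norm_num, pow_mul, hs4, one_pow]
    have hpow := apply_eq_pow_val_modularCyclotomicCharacter σ h8 hs8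
    rw [hσs] at hpow
    -- `m = χ̄₈(σ).val` is odd; `m ≡ 3 (mod 4)` would give `s = s³ = −s`
    have hmod : (u8 : ZMod 8).val % 4 = 1 := by
      have hodd : (u8 : ZMod 8).val % 2 = 1 := by
        have h := hmodd
        rw [Int.odd_coe_nat] at h
        exact Nat.odd_iff.mp h
      rcases (show (u8 : ZMod 8).val % 4 = 1 ∨ (u8 : ZMod 8).val % 4 = 3 by omega) with h1 | h3
      · exact h1
      · exfalso
        have hmn : (u8 : ZMod 8).val = 4 * ((u8 : ZMod 8).val / 4) + (2 + 1) := by omega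
        rw [← hu8def, hmn, pow_add, pow_mul, hs4, one_pow, one_mul, pow_succ, hs] at hpow
        have hs0 : s = 0 := by linear_combination hpow / 2
        rw [hs0] at hs
        norm_num at hs
    have hm4 : ((((u8 : ZMod 8).val : ℕ) : ℤ) : ZMod 4) = 1 := by
      rw [Int.cast_natCast, ← ZMod.natCast_mod, hmod, Nat.cast_one]
    rw [hm4, MulChar.map_one]
  · -- `α` odd, `m' ≡ 3 (4)`: `ε𝔭 = −1`, `B` odd, `s² = −2`, so `χ₈'(χ̄₈ σ) = 1`
    intro hα hχ
    have hε := hε_of_χ₄ hχ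
    rw [if_pos rfl] at hε
    obtain ⟨k, hk⟩ := h5.mp hα.neg_one_pow
    obtain ⟨s, -, hσs, hs⟩ := key (-k - 1) 1 (by rw [hk]; ring)
    rw [hε, pow_one, Int.cast_neg, Int.cast_one, neg_one_mul] at hs
    have h := (apply_eq_self_iff_of_sq_eq_neg_two σ h8 hs).mp hσs
    rwa [Int.cast_natCast, ZMod.natCast_zmod_val]

open IdeleClassGroup in
/-- **[Liu2021, Thm. 4.18 (3), (NT) at `𝔭 ∣ 2`] modulo `HilbertSymbolNormCompatAtTwo`: `(χ_{cyc,2}(σ), θ)_𝔭 = 1`** —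
the `2`-adic cyclotomic character of `σ ∈ Aut(ℂ/M_μ)`, read in `L⁺_𝔭` through the canonical `ℚ₂`-algebra structure
(`LocalField.adicCompletionPadicAlgebra`), is a norm from `L_w = L⁺_𝔭(√θ)`, `θ = cmQuadraticGenerator L`, `ψ = μ`
conjugate symplectic, `σ : ℂ ≃+* ℂ` fixing `M_μ = fieldOfValues L ψ` pointwise (the uniform formulation of the printed
«`M_{E/F} ∈ {ℚ(√−1), ℚ(√2), ℚ(√−2)} ⊆ M_μ`», see the module docstring).
[cite: Liu2021, proof of Thm. 4.18 (3), l. 2279–2289] [cite: Serre1973, Ch. III §1.2 Thm 1] -/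
theorem hilbertSymbol_cyclotomicCharacter_cmQuadraticGenerator_eq_one_of_normCompatAtTwo
    (hNC : HilbertSymbolNormCompatAtTwo)
    {ψ : IdeleClassGroup L →ₜ* Circle} (hψ : IsConjugateSymplectic L ψ)
    (σ : ℂ ≃+* ℂ) (hσ : ∀ z ∈ fieldOfValues L ψ, σ z = z)
    (𝔭 : HeightOneSpectrum (𝓞 L⁺)) (h2 : ((2 : ℕ) : 𝓞 L⁺) ∈ 𝔭.asIdeal) :
    letI := LocalField.adicCompletionPadicAlgebra 𝔭 2 h2
    hilbertSymbol (𝔭.adicCompletion L⁺)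
        (algebraMap ℚ_[2] (𝔭.adicCompletion L⁺) (((cyclotomicCharacter ℂ 2 σ : ℤ_[2]ˣ) : ℤ_[2]) : ℚ_[2]))
        (algebraMap (L⁺) (𝔭.adicCompletion L⁺) ((cmQuadraticGenerator L : 𝓞 L⁺) : L⁺)) = 1 := by
  letI := LocalField.adicCompletionPadicAlgebra 𝔭 2 h2
  haveI : CharZero (𝔭.adicCompletion L⁺) := charZero_of_injective_algebraMap (algebraMap (L⁺) _).injective
  -- `L⁺_𝔭 / ℚ₂` is finite, so the named fact applies to it
  haveI : FiniteDimensional ℚ_[2] (𝔭.adicCompletion L⁺) := by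
    haveI := 𝔭.isPrime
    refine Module.finite_of_finrank_pos ?_
    rw [finrank_adicCompletionPadicAlgebra_eq 2 𝔭 h2]
    exact Nat.mul_pos (Ideal.ramificationIdx_pos _ _) (Ideal.inertiaDeg_pos _ _)
  exact hilbertSymbol_cyclotomicCharacter_cmQuadraticGenerator_eq_one_of_localNormCompat hψ σ hσ 𝔭 h2
    (fun a b ha hb => hNC (𝔭.adicCompletion L⁺) a b ha hb)

end CM

end Literature.NumberTheory.Automorphic.Liu2021

end
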